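import Summits.ABC.IUTFork.Repair.CandJoshi24Schema
import HarnessLib

/-!
# IUT REPAIR BRANCH (LADDER-ABC:A2.RP), class (iii) JOSHI, j2 — «VAL(U)» III: THE SCHEMA over the scalar group `U`, hull side —
# the typed Statement ⟺ `U ≠ ⊥` (then `−|log(Θ)| = 0`), independently of S; the packaged schema; instances `⊥`, `⟨4⟩`, `⟨16⟩`

Record file of the abc-iut cell's IUT REPAIR BRANCH (seat abc-iut-rp-j2, gen 3; row RP-J05 door (a), price SCHEMA; sequel to
`Repair/CandJoshi24` and `CandJoshi24Schema`). TAKES NO SIDE on [IUTchIII] Cor. 3.12 or on any author. PROOF-ONLY but for the set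
`uPos` and the two scalars `four`, `sixteen` (no `Prop` def, no `Prop` fact); interface-level toy over `toyIndex` (`l⋇ = 2`); typed ≠
proved ≠ endorsed.
RESULTS, for every subgroup `U ≤ ℚˣ` of POSITIVE scalars:
* §5 the union of the possible images of the Θ-pilot at a label of `𝔽_l^⋇` is `⋃_{u ∈ U} H_{u·j²}` (`u_sUnion_possibleImages`). For
  `U = ⊥` it is the honest `H_{j²}`: hull `H_{j²}`, `−|log(Θ)|` the honest procession average `−(5/2)·log p < −log p = −|log(q)|`, so
  **the typed Statement is FALSE** (`bot_not_statement`: the pinned countermodel re-drawn in the value chart). For `U ≠ ⊥` it is the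
  OPEN half-line `{v > 0}` (the thresholds `u·j²` accumulate at `0`): hull = the scale-invariant unit shell `H_0`, `−|log(Θ)| = 0`,
  **ThetaFinite, BridgeHyps and the typed Statement HOLD** (`ne_bot_statement`) — WHETHER OR NOT S holds.
* §6 **`value_chart_schema`**: honest interface for every `U` (typed Thm. 3.11 ∧ PinnedRegions3 ∧ BridgeHyps ∧ `|log(q)| > 0` ∧ exact
  `j²` ∧ label-independent q-volume ∧ Step (x) hAdm) ∧ (S ⟺ `¼ ∈ U`) ∧ (Step (x) invariance ⟺ `U = ⊥`) ∧ (Statement ⟺ `U ≠ ⊥`) ∧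
  (Statement ⟹ `−|log(Θ)| = 0`); corollaries Statement ⟺ ¬Step (x) ⟺ H_J21-5. Instances: `bot_cells` (`U = ⊥`: S ✗, Step (x) ✓,
  Statement ✗ honest); `sixteen_cells` (`U = ⟨16⟩`, `¼ ∉ U` by parity: S ✗ yet Statement ✓ idle, Step (x) ✗ — the value-chart twin
  of block E's parity countermodel); `four_cells` (`U = ⟨4⟩`, Joshi's own law group: S ✓, Statement ✓ idle). `CandJoshi23`'s VAL is
  the instance `U =` all positive rationals.
CENSUS SENTENCE (A2.RP, class (iii), door (a); neutral): in the value chart the typed inequality is decided by the scalar group ALONE —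
every non-isometric positive scalar indeterminacy group whatsoever makes `−|log(q)| ≤ −|log(Θ)|` TRUE AND IDLE (`−|log(Θ)| = μ(unit
shell) = 0`), the isometric one makes it honestly FALSE, and the residual S is an independent membership question (`¼ ∈ U`):
`⊥` (S ✗, Stmt ✗) · `⟨16⟩` (S ✗, Stmt ✓) · `⟨4⟩` (S ✓, Stmt ✓); no `U` gives S with an honest (non-idle) inequality. Value-chart
companion of abc-iut-rp-s2's `ObstructionSS2` (Haar chart: S-reaching rescalings ⟹ `−|log(Θ)| = +∞`) and of block E's index criterion
(Haar chart: every S-reaching enlargement leaves `−|log(Θ)|` undefined). It prices the READING «Θ_gau-scaling ∈ (Ind1)/(Ind2)»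
(arXiv:2303.01662 Thm. 6.9.1 (1)(3)(4), Rmk. 8.5.2; arXiv:2106.11452 Thm. (th:main3)); it does not read [IUTchIII], whose (Ind1)/(Ind2)
are isometries (Step (x) p. 181 l. 5–13). [claim: Mochizuki2012, status: disputed] [claim: Joshi2023ATS2Local, status: disputed]
[claim: Joshi2021ATS1, status: disputed] [cite: ScholzeStix2018, §2.2 p. 10]
-/

noncomputable section

open Set

namespace Summit.ABC.IUTFork.Repair.CandJoshi24

open Thm311 Cor312 Cor312.Checks Cor312.IdentifiedNonVacuity Cor312Vol Cor312Vol.NaiveWitness Cor312Vol.UnitWitness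
  Cor312Vol.PinnedWitness Literature.IUT.LogThetaLattice Summit.ABC.IUTFork.Repair Summit.ABC.IUTFork.Repair.ScalarShells
  Summit.ABC.IUTFork.Repair.ScalarShellsThm311

variable (p : ℕ) (U : Subgroup ℚˣ)

/-! ## 5. Possible images and the Θ-hull: honest for `U = ⊥`, the unit shell for `U ≠ ⊥` -/

/-- **The union of the possible images of the Θ-pilot at a label of `𝔽_l^⋇` is `⋃_{u ∈ U} H_{u·j²}`** (the `U`-orbit of the honest
`H_{j²}`; every `u ∈ U` occurs, by `uHead (u, u, u)`). [folklore] -/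
theorem u_sUnion_possibleImages (hU : U ≤ Units.posSubgroup ℚ) (i : Fin toyIndex.lstar) (vQ : toyIndex.VQ) :
    ⋃₀ (uSetting p U).possibleImages (Setting.labelSucc i) vQ =
      {x | ∃ u ∈ U, ((u : ℚˣ) : ℚ) * (jsq (Setting.labelSucc i) : ℚ) ≤ line _ vQ x} := by
  apply Set.Subset.antisymm
  · rintro x ⟨V, ⟨Φ, hΦ, rfl⟩, hx⟩
    obtain ⟨u, hu, hΦc⟩ := (ScalarShells.actsByScalars_of_mem_closure hΦ).scalar _ vQ
    rw [uSetting_thetaRegion3, image_uHalf_of_line_eq p U _ ((Units.mem_posSubgroup _).1 (hU hu)) hΦc] at hx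
    exact ⟨u, hu, hx⟩
  · rintro x ⟨u, hu, hx⟩
    refine ⟨uHead p U (fun _ => u) _ vQ '' (uSetting p U).thetaRegion3 _ vQ, ⟨uHead p U fun _ => u, uHead_mem_closure fun _ => hu, rfl⟩, ?_⟩
    rw [uSetting_thetaRegion3, image_uHalf_uHead_const p U ((Units.mem_posSubgroup _).1 (hU hu))]
    exact hx

/-- The hull of a half-line is itself. [folklore] -/
theorem uFrame_hull_uHalf (j : toyIndex.Label) (vQ : toyIndex.VQ) (a : ℚ) :
    (uFrame p U j vQ).hull (uHalf p U j vQ a) = uHalf p U j vQ a := by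
  unfold HullFrame.hull
  rw [if_pos (show (uFrame p U j vQ).IsBounded (uHalf p U j vQ a) from ⟨a, subset_rfl⟩)]
  exact Set.Subset.antisymm (Set.sInter_subset_of_mem ⟨⟨a, rfl⟩, subset_rfl⟩) (Set.subset_sInter fun H hH => hH.2)

/-- **`U = ⊥`: the union of the possible images is the honest `H_{j²}` itself.** [folklore] -/
theorem bot_sUnion_possibleImages (i : Fin toyIndex.lstar) (vQ : toyIndex.VQ) :
    ⋃₀ (uSetting p ⊥).possibleImages (Setting.labelSucc i) vQ = uHalf p ⊥ _ vQ (jsq (Setting.labelSucc i) : ℚ) := by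
  rw [u_sUnion_possibleImages p ⊥ bot_le]
  ext x
  constructor
  · rintro ⟨u, hu, hx⟩
    rw [Subgroup.mem_bot.1 hu, Units.val_one, one_mul] at hx
    exact hx
  · intro hx
    exact ⟨1, Subgroup.one_mem _, by rw [Units.val_one, one_mul]; exact hx⟩

/-- `U = ⊥`: the union admits its hull … [folklore] -/
theorem bot_hullDefined (i : Fin toyIndex.lstar) (vQ : toyIndex.VQ) : (uSetting p ⊥).HullDefined (Setting.labelSucc i) vQ := by
  unfold Setting.HullDefined
  rw [bot_sUnion_possibleImages]
  exact ⟨⟨_, subset_rfl⟩, ⟨_, subset_rfl, fun b hb => le_of_uHalf_subset p ⊥ hb⟩⟩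

/-- **`U = ⊥`: the Θ-hull is the honest `H_{j²}`** … [folklore] -/
theorem bot_thetaHull (i : Fin toyIndex.lstar) (vQ : toyIndex.VQ) :
    (uSetting p ⊥).thetaHull (Setting.labelSucc i) vQ = uHalf p ⊥ _ vQ (jsq (Setting.labelSucc i) : ℚ) := by
  unfold Setting.thetaHull
  rw [bot_sUnion_possibleImages]
  exact uFrame_hull_uHalf p ⊥ _ vQ _

/-- … the local Θ-term is the honest `−j²·log p` … [folklore] -/
theorem bot_thetaLocal (i : Fin toyIndex.lstar) (vQ : toyIndex.VQ) :
    (uSetting p ⊥).thetaLocal (Setting.labelSucc i) vQ = ((-((jsq (Setting.labelSucc i) : ℚ) : ℝ) * Real.log p : ℝ) : WithTop ℝ) := by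
  unfold Setting.thetaLocal
  rw [if_pos (bot_hullDefined p i vQ)]
  show (((uVol p ⊥ _ vQ ((uSetting p ⊥).thetaHull (Setting.labelSucc i) vQ) : ℝ) : WithTop ℝ)) = _
  rw [bot_thetaHull, uVol_uHalf]

/-- … `ThetaFinite` holds … [folklore] -/
theorem bot_thetaFinite : (uSetting p ⊥).ThetaFinite :=
  ⟨fun i vQ => by rw [bot_thetaLocal]; exact WithTop.coe_ne_top, fun _ => Set.toFinite _⟩

/-- … and `−|log(Θ)|` is the honest procession average of the `−j²·log p`. [folklore] -/
theorem bot_negLogTheta : (uSetting p ⊥).negLogTheta =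
    ((processionNormalized fun i : Fin toyIndex.lstar => -((jsq (Setting.labelSucc i) : ℚ) : ℝ) * Real.log p : ℝ) : WithTop ℝ) := by
  unfold Setting.negLogTheta
  rw [if_pos (bot_thetaFinite p)]
  have h : (fun i : Fin toyIndex.lstar => ∑ᶠ vQ : toyIndex.VQ, ((uSetting p ⊥).thetaLocal (Setting.labelSucc i) vQ).untopD 0) =
      fun i => -((jsq (Setting.labelSucc i) : ℚ) : ℝ) * Real.log p := by
    funext i; rw [finsum_unique, bot_thetaLocal]; rfl
  rw [h]

/-- `1 ≤ j²` on `𝔽_l^⋇`. [folklore] -/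
theorem one_le_jsq_labelSucc (i : Fin toyIndex.lstar) : (1 : ℚ) ≤ (jsq (Setting.labelSucc i) : ℚ) := by
  unfold jsq
  rw [show ((Setting.labelSucc i : toyIndex.Label) : ℕ) = (i : ℕ) + 1 from Fin.val_succ i]
  exact_mod_cast Nat.one_le_pow _ _ (Nat.succ_pos _)

/-- **`U = ⊥`: THE TYPED STATEMENT OF COR. 3.12 IS FALSE in the value chart** (`−|log(Θ)| = −(5/2)·log p < −log p = −|log(q)|`: the
isometric case carries the pinned countermodel's honest numbers; strictness of the procession average as in abc-iut-c312's
`Thm311.Real.processionNormalized_lt_of_le_of_lt`). [claim: Mochizuki2012, status: disputed] -/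
theorem bot_not_statement [Fact p.Prime] : ¬ (uSetting p ⊥).Statement := by
  rintro ⟨-, hle⟩
  rw [bot_negLogTheta, u_negLogQ, ← processionNormalized_const (show 0 < toyIndex.lstar by decide) (-Real.log p),
    WithTop.coe_le_coe] at hle
  have hl := log_p_pos p
  have hlt : processionNormalized (fun i : Fin toyIndex.lstar => -((jsq (Setting.labelSucc i) : ℚ) : ℝ) * Real.log p) <
      processionNormalized (fun _ : Fin toyIndex.lstar => -Real.log p) := by
    unfold processionNormalized
    refine div_lt_div_of_pos_right (Finset.sum_lt_sum (fun i _ => ?_)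
      ⟨(⟨1, by decide⟩ : Fin toyIndex.lstar), Finset.mem_univ _, ?_⟩) (by exact_mod_cast (show 0 < toyIndex.lstar by decide))
    · have h1 : (1 : ℝ) ≤ ((jsq (Setting.labelSucc i) : ℚ) : ℝ) := by exact_mod_cast one_le_jsq_labelSucc i
      nlinarith
    · have h4 : ((jsq (Setting.labelSucc (⟨1, by decide⟩ : Fin toyIndex.lstar)) : ℚ) : ℝ) = 4 := by exact_mod_cast jsq_two
      rw [h4]; linarith
  exact absurd hle (not_le.2 hlt)

/-- The OPEN positive half-line `{v > 0}`. [folklore] -/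
def uPos (j : toyIndex.Label) (vQ : toyIndex.VQ) : Set ((uShells p U).Packet j vQ) := {x | 0 < line j vQ x}

variable {U} in
/-- A nontrivial subgroup of `ℚˣ` contains a scalar `< 1` (`u` or `u⁻¹`). [folklore] -/
theorem exists_lt_one (hne : U ≠ ⊥) : ∃ u ∈ U, ((u : ℚˣ) : ℚ) < 1 := by
  obtain ⟨u, hu, hne1⟩ := exists_ne_one_of_ne_bot hne
  by_cases hlt : (u : ℚ) < 1
  · exact ⟨u, hu, hlt⟩
  · have hne1' : (u : ℚ) ≠ 1 := fun h => hne1 (Units.ext (h.trans Units.val_one.symm))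
    have hgt : 1 < (u : ℚ) := lt_of_le_of_ne (not_lt.1 hlt) (Ne.symm hne1')
    refine ⟨u⁻¹, U.inv_mem hu, ?_⟩
    rw [Units.val_inv_eq_inv_val]
    exact inv_lt_one_of_one_lt₀ hgt

/-- **`U ≠ ⊥`: the union of the possible images is the OPEN half-line `{v > 0}`** — the thresholds `u·j²`, `u ∈ U`, accumulate at `0`
(`uⁿ → 0` for a scalar `u < 1` of `U`). [folklore] -/
theorem ne_bot_sUnion_possibleImages (hU : U ≤ Units.posSubgroup ℚ) (hne : U ≠ ⊥) (i : Fin toyIndex.lstar) (vQ : toyIndex.VQ) :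
    ⋃₀ (uSetting p U).possibleImages (Setting.labelSucc i) vQ = uPos p U _ vQ := by
  rw [u_sUnion_possibleImages p U hU]
  apply Set.Subset.antisymm
  · rintro x ⟨u, hu, hx⟩
    exact lt_of_lt_of_le (mul_pos ((Units.mem_posSubgroup _).1 (hU hu)) (CandJoshi23.jsq_labelSucc_pos i)) hx
  · intro x hx
    have hx' : 0 < line _ vQ x := hx
    obtain ⟨u, hu, hu1⟩ := exists_lt_one hne
    obtain ⟨n, hn⟩ := exists_pow_lt_of_lt_one (div_pos hx' (CandJoshi23.jsq_labelSucc_pos i)) hu1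
    refine ⟨u ^ n, U.pow_mem hu n, ?_⟩
    rw [Units.val_pow_eq_pow_val]
    have := (lt_div_iff₀ (CandJoshi23.jsq_labelSucc_pos i)).1 hn
    exact this.le

/-- `{v > 0} ⊆ H_b ⟺ b ≤ 0`. [folklore] -/
theorem uPos_subset_uHalf_iff (j : toyIndex.Label) (vQ : toyIndex.VQ) (b : ℚ) : uPos p U j vQ ⊆ uHalf p U j vQ b ↔ b ≤ 0 := by
  constructor
  · intro h
    by_contra hb
    have hb : 0 < b := not_le.mp hb
    have hmem : uPt p U j vQ (b / 2) ∈ uPos p U j vQ := by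
      show 0 < line j vQ (uPt p U j vQ (b / 2)); rw [line_uPt]; linarith
    have h2 := h hmem
    rw [mem_uHalf, line_uPt] at h2
    linarith
  · intro hb x hx
    exact le_trans hb (le_of_lt hx)

/-- **The holomorphic hull of `{v > 0}` is the unit shell `H_0`.** [folklore] -/
theorem uFrame_hull_uPos (j : toyIndex.Label) (vQ : toyIndex.VQ) : (uFrame p U j vQ).hull (uPos p U j vQ) = uHalf p U j vQ 0 := by
  have h0 : uPos p U j vQ ⊆ uHalf p U j vQ 0 := (uPos_subset_uHalf_iff p U j vQ 0).2 le_rfl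
  unfold HullFrame.hull
  rw [if_pos (show (uFrame p U j vQ).IsBounded (uPos p U j vQ) from ⟨0, h0⟩)]
  apply Set.Subset.antisymm
  · exact Set.sInter_subset_of_mem ⟨⟨0, rfl⟩, h0⟩
  · refine Set.subset_sInter ?_
    rintro H ⟨⟨b, rfl⟩, hb⟩
    exact uHalf_anti p U ((uPos_subset_uHalf_iff p U j vQ b).1 hb)

/-- `U ≠ ⊥`: the union admits its hull (bounded below, infimum `0` attained) … [folklore] -/
theorem ne_bot_hullDefined (hU : U ≤ Units.posSubgroup ℚ) (hne : U ≠ ⊥) (i : Fin toyIndex.lstar) (vQ : toyIndex.VQ) :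
    (uSetting p U).HullDefined (Setting.labelSucc i) vQ := by
  unfold Setting.HullDefined
  rw [ne_bot_sUnion_possibleImages p U hU hne]
  exact ⟨⟨0, (uPos_subset_uHalf_iff p U _ vQ 0).2 le_rfl⟩,
    ⟨0, (uPos_subset_uHalf_iff p U _ vQ 0).2 le_rfl, fun b hb => (uPos_subset_uHalf_iff p U _ vQ b).1 hb⟩⟩

/-- **`U ≠ ⊥`: the Θ-hull `^{n,∘}𝒰` is the WHOLE UNIT SHELL `H_0`** … [folklore] -/
theorem ne_bot_thetaHull (hU : U ≤ Units.posSubgroup ℚ) (hne : U ≠ ⊥) (i : Fin toyIndex.lstar) (vQ : toyIndex.VQ) :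
    (uSetting p U).thetaHull (Setting.labelSucc i) vQ = uHalf p U _ vQ 0 := by
  unfold Setting.thetaHull
  rw [ne_bot_sUnion_possibleImages p U hU hne]
  exact uFrame_hull_uPos p U _ vQ

/-- … the local Θ-term is `μ(H_0) = 0` … [folklore] -/
theorem ne_bot_thetaLocal (hU : U ≤ Units.posSubgroup ℚ) (hne : U ≠ ⊥) (i : Fin toyIndex.lstar) (vQ : toyIndex.VQ) :
    (uSetting p U).thetaLocal (Setting.labelSucc i) vQ = ((0 : ℝ) : WithTop ℝ) := by
  unfold Setting.thetaLocal
  rw [if_pos (ne_bot_hullDefined p U hU hne i vQ)]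
  show (((uVol p U _ vQ ((uSetting p U).thetaHull (Setting.labelSucc i) vQ) : ℝ) : WithTop ℝ)) = _
  rw [ne_bot_thetaHull p U hU hne, uVol_uHalf]
  simp

/-- … `ThetaFinite` holds … [folklore] -/
theorem ne_bot_thetaFinite (hU : U ≤ Units.posSubgroup ℚ) (hne : U ≠ ⊥) : (uSetting p U).ThetaFinite :=
  ⟨fun i vQ => by rw [ne_bot_thetaLocal p U hU hne]; exact WithTop.coe_ne_top, fun _ => Set.toFinite _⟩

/-- … **`−|log(Θ)| = 0`** … [folklore] -/
theorem ne_bot_negLogTheta (hU : U ≤ Units.posSubgroup ℚ) (hne : U ≠ ⊥) : (uSetting p U).negLogTheta = ((0 : ℝ) : WithTop ℝ) := by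
  unfold Setting.negLogTheta
  rw [if_pos (ne_bot_thetaFinite p U hU hne)]
  have h : (fun i : Fin toyIndex.lstar =>
      ∑ᶠ vQ : toyIndex.VQ, ((uSetting p U).thetaLocal (Setting.labelSucc i) vQ).untopD 0) = fun _ => (0 : ℝ) := by
    funext i; rw [finsum_unique, ne_bot_thetaLocal p U hU hne]; rfl
  rw [h, processionNormalized_const (by decide)]

/-- **`U ≠ ⊥`: THE TYPED STATEMENT OF COR. 3.12 HOLDS in the value chart** (`−|log(q)| = −log p ≤ 0 = −|log(Θ)|`, strict) — for EVERY
nontrivial positive scalar group, whether or not S holds. [claim: Mochizuki2012, status: disputed] -/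
theorem ne_bot_statement [Fact p.Prime] (hU : U ≤ Units.posSubgroup ℚ) (hne : U ≠ ⊥) : (uSetting p U).Statement := by
  refine ⟨by rw [ne_bot_negLogTheta p U hU hne]; exact WithTop.coe_ne_top, ?_⟩
  rw [ne_bot_negLogTheta p U hU hne, u_negLogQ]
  have := log_p_pos p
  exact WithTop.coe_le_coe.2 (by linarith)

/-- `ThetaFinite` holds for EVERY `U` inside the positive rationals (both cases). [folklore] -/
theorem u_thetaFinite (hU : U ≤ Units.posSubgroup ℚ) : (uSetting p U).ThetaFinite := by
  rcases eq_or_ne U ⊥ with rfl | hne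
  · exact bot_thetaFinite p
  · exact ne_bot_thetaFinite p U hU hne

/-- **`BridgeHyps` HOLDS for every `U` inside the positive rationals.** [claim: Mochizuki2012, status: disputed] -/
theorem u_bridgeHyps [Fact p.Prime] (hU : U ≤ Units.posSubgroup ℚ) : BridgeHyps (uSetting p U) where
  mono := u_logvolMono p U
  image_adm := fun i vQ V hV => by
    obtain ⟨Φ, hΦ, rfl⟩ := hV
    obtain ⟨u, hu, hΦc⟩ := (ScalarShells.actsByScalars_of_mem_closure hΦ).scalar _ vQ
    rw [uSetting_thetaRegion3, image_uHalf_of_line_eq p U _ ((Units.mem_posSubgroup _).1 (hU hu)) hΦc]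
    exact ⟨_, rfl⟩
  image_fin := fun _ => Set.toFinite _
  hul_nonempty := fun j vQ H hH => by
    obtain ⟨a, rfl⟩ := hH
    exact ⟨uPt p U j vQ a, uPt_mem_uHalf p U j vQ a⟩
  theta_nonempty := fun i vQ => by
    rw [uSetting_thetaRegion3]
    exact ⟨_, uPt_mem_uHalf p U _ vQ _⟩
  finite := u_thetaFinite p U hU

/-! ## 6. THE SCHEMA, and three instances -/

/-- **Statement ⟺ `U ≠ ⊥`.** [claim: Mochizuki2012, status: disputed] -/
theorem u_statement_iff [Fact p.Prime] (hU : U ≤ Units.posSubgroup ℚ) : (uSetting p U).Statement ↔ U ≠ ⊥ :=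
  ⟨fun hS hb => by subst hb; exact bot_not_statement p hS, fun hne => ne_bot_statement p U hU hne⟩

/-- **Statement ⟺ ¬(Step (x) log-volume invariance)** — in the value chart the typed inequality holds EXACTLY where print's Step (x)
isometry clause fails. [claim: Mochizuki2012, status: disputed] -/
theorem u_statement_iff_not_logvolInvariant [Fact p.Prime] (hU : U ≤ Units.posSubgroup ℚ) :
    (uSetting p U).Statement ↔ ¬ (uData p U).LogvolInvariant := by
  rw [u_statement_iff p U hU, u_logvolInvariant_iff p U hU]

/-- **Statement ⟺ H_J21-5** — Joshi's non-isometry hypothesis IS the typed (idle) Statement in the value chart. [claim: Joshi2021ATS1, status: disputed] -/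
theorem u_statement_iff_H5 [Fact p.Prime] (hU : U ≤ Units.posSubgroup ℚ) (n : ℤ) :
    (uSetting p U).Statement ↔ JoshiNonIsometricIndeterminacy (uSituation p U) n := by
  rw [u_statement_iff p U hU, u_H5_iff p U hU]

/-- **`value_chart_schema` — THE VALUE-CHART SCHEMA over the positive scalar groups `U`**: the honest interface holds for every `U`
(typed Thm. 3.11 ∧ PinnedRegions3 ∧ BridgeHyps ∧ `|log(q)| > 0` ∧ exact `j²` ∧ label-independent q-volume ∧ Step (x) hAdm); the
residual S ⟺ `¼ ∈ U`; Step (x) invariance ⟺ `U = ⊥`; the typed Statement ⟺ `U ≠ ⊥`, and then `−|log(Θ)| = 0`.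
[claim: Joshi2023ATS2Local, status: disputed] -/
theorem value_chart_schema [Fact p.Prime] (hU : U ≤ Units.posSubgroup ℚ) :
    ((uFull p U).Statement ∧ PinnedRegions3 (uFull p U).toLatticeSituation (uSetting p U) (uRho p U) (uQDatum p U) ∧
      BridgeHyps (uSetting p U) ∧ (uSetting p U).AbsLogQPos ∧
      (∀ (i : Fin toyIndex.lstar) (vQ : toyIndex.VQ),
        ((uFull p U).D (uSetting p U).n).logvol _ vQ (uRho p U ((uFull p U).D (uSetting p U).n).Ψ (Setting.labelSucc i) vQ) =
          (((i : ℕ) + 1 : ℕ) : ℝ) ^ 2 * (uSetting p U).qLocal (Setting.labelSucc i) vQ) ∧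
      (∀ (i i' : Fin toyIndex.lstar) (vQ : toyIndex.VQ),
        (uSetting p U).qLocal (Setting.labelSucc i) vQ = (uSetting p U).qLocal (Setting.labelSucc i') vQ) ∧
      (∀ Φ ∈ (uShells p U).Ind1Family ∪ (uShells p U).Ind2Family, ∀ (j : toyIndex.Label) (vQ : toyIndex.VQ)
        (B : Set ((uShells p U).Packet j vQ)), (uData p U).Adm j vQ B ↔ (uData p U).Adm j vQ (Φ j vQ '' B))) ∧
    (PilotKummerIndRelated (uFull p U).toLatticeSituation (uSetting p U) (uRho p U) (uQDatum p U) ↔ CandJoshi23.quarter ∈ U) ∧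
    ((uData p U).LogvolInvariant ↔ U = ⊥) ∧
    ((uSetting p U).Statement ↔ U ≠ ⊥) ∧
    ((uSetting p U).Statement → (uSetting p U).negLogTheta = ((0 : ℝ) : WithTop ℝ)) :=
  ⟨⟨uFull_statement p U, u_pinnedRegions3 p U hU, u_bridgeHyps p U hU, u_absLogQPos p U, u_hscaled p U,
      fun i i' vQ => by rw [EvalValUProfile.valU_qLocal, EvalValUProfile.valU_qLocal], u_hAdm p U hU⟩,
    u_residual_iff p U hU, u_logvolInvariant_iff p U hU, u_statement_iff p U hU,
    fun hS => ne_bot_negLogTheta p U hU ((u_statement_iff p U hU).1 hS)⟩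

/-- `¼ ≠ 1`: the trivial group does not contain the relating scalar. [folklore] -/
theorem quarter_ne_one : CandJoshi23.quarter ≠ 1 := fun h => by
  have h1 : ((CandJoshi23.quarter : ℚˣ) : ℚ) = 1 := by rw [h, Units.val_one]
  exact absurd h1 (by show (4⁻¹ : ℚ) ≠ 1; norm_num)

/-- **Instance `U = ⊥` (isometric): S ✗, Step (x) ✓, Statement ✗ (honest), with typed Thm. 3.11 ∧ pins ∧ BridgeHyps** — the pinned
countermodel's cell, re-drawn in the value chart. [claim: Mochizuki2012, status: disputed] -/
theorem bot_cells [Fact p.Prime] :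
    (uFull p ⊥).Statement ∧ PinnedRegions3 (uFull p ⊥).toLatticeSituation (uSetting p ⊥) (uRho p ⊥) (uQDatum p ⊥) ∧
      BridgeHyps (uSetting p ⊥) ∧ (uData p ⊥).LogvolInvariant ∧
      ¬ PilotKummerIndRelated (uFull p ⊥).toLatticeSituation (uSetting p ⊥) (uRho p ⊥) (uQDatum p ⊥) ∧
      ¬ (uSetting p ⊥).Statement :=
  ⟨uFull_statement p ⊥, u_pinnedRegions3 p ⊥ bot_le, u_bridgeHyps p ⊥ bot_le, (u_logvolInvariant_iff p ⊥ bot_le).2 rfl,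
    fun h => quarter_ne_one (Subgroup.mem_bot.1 ((u_residual_iff p ⊥ bot_le).1 h)), bot_not_statement p⟩

/-- The scalar `4` (Joshi's law `v ↦ 2²·v` itself) and `16 = 4²`. [folklore] -/
def four : ℚˣ := Units.mk0 4 (by norm_num)

/-- `16 = 4²`. [folklore] -/
def sixteen : ℚˣ := Units.mk0 16 (by norm_num)

/-- `⟨4⟩` and `⟨16⟩` are nontrivial groups of positive scalars; `¼ ∈ ⟨4⟩`, `¼ ∉ ⟨16⟩` (parity of the exponent). [folklore] -/
theorem four_sixteen_facts :
    Subgroup.zpowers four ≤ Units.posSubgroup ℚ ∧ Subgroup.zpowers four ≠ ⊥ ∧ CandJoshi23.quarter ∈ Subgroup.zpowers four ∧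
      Subgroup.zpowers sixteen ≤ Units.posSubgroup ℚ ∧ Subgroup.zpowers sixteen ≠ ⊥ ∧ CandJoshi23.quarter ∉ Subgroup.zpowers sixteen := by
  refine ⟨Subgroup.zpowers_le.2 ((Units.mem_posSubgroup _).2 (by show (0 : ℚ) < 4; norm_num)),
    Subgroup.zpowers_ne_bot.2 (fun h => absurd (congrArg Units.val h) (by show (4 : ℚ) ≠ 1; norm_num)),
    Subgroup.mem_zpowers_iff.2 ⟨-1, Units.ext (by rw [zpow_neg_one, Units.val_inv_eq_inv_val]; rfl)⟩,
    Subgroup.zpowers_le.2 ((Units.mem_posSubgroup _).2 (by show (0 : ℚ) < 16; norm_num)),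
    Subgroup.zpowers_ne_bot.2 (fun h => absurd (congrArg Units.val h) (by show (16 : ℚ) ≠ 1; norm_num)), fun h => ?_⟩
  obtain ⟨k, hk⟩ := Subgroup.mem_zpowers_iff.1 h
  have hk' : (16 : ℚ) ^ k = 4⁻¹ := by
    have := congrArg Units.val hk
    rw [Units.val_zpow_eq_zpow_val] at this
    exact this
  have h2 : (4 : ℚ) ^ (2 * k) = (4 : ℚ) ^ (-1 : ℤ) := by
    rw [zpow_mul, zpow_neg_one, ← hk']; norm_num
  have := zpow_right_injective₀ (by norm_num : (0 : ℚ) < 4) (by norm_num : (4 : ℚ) ≠ 1) h2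
  omega

/-- **Instance `U = ⟨16⟩` (non-isometric, `¼ ∉ U`): S ✗ and yet Statement ✓ with `−|log(Θ)| = 0`, ¬Step (x)** — the value-chart twin
of block E's parity countermodel: destroying log-volume invariance without reaching S makes the inequality TRUE and IDLE here
(UNDEFINED in the Haar chart). [claim: Mochizuki2012, status: disputed] -/
theorem sixteen_cells [Fact p.Prime] :
    ¬ PilotKummerIndRelated (uFull p (Subgroup.zpowers sixteen)).toLatticeSituation (uSetting p _) (uRho p _) (uQDatum p _) ∧
      (uSetting p (Subgroup.zpowers sixteen)).Statement ∧ (uSetting p (Subgroup.zpowers sixteen)).negLogTheta = ((0 : ℝ) : WithTop ℝ) ∧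
      ¬ (uData p (Subgroup.zpowers sixteen)).LogvolInvariant ∧ BridgeHyps (uSetting p (Subgroup.zpowers sixteen)) ∧
      PinnedRegions3 (uFull p (Subgroup.zpowers sixteen)).toLatticeSituation (uSetting p _) (uRho p _) (uQDatum p _) := by
  obtain ⟨-, -, -, h16, hne, hq⟩ := four_sixteen_facts
  exact ⟨fun h => hq ((u_residual_iff p _ h16).1 h), ne_bot_statement p _ h16 hne, ne_bot_negLogTheta p _ h16 hne,
    fun h => hne ((u_logvolInvariant_iff p _ h16).1 h), u_bridgeHyps p _ h16, u_pinnedRegions3 p _ h16⟩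

/-- **Instance `U = ⟨4⟩` (Joshi's own law group): S ✓ and Statement ✓ with `−|log(Θ)| = 0`, ¬Step (x)** — door (a) through the
smallest group containing the relating scalar already accumulates at the shell (`CandJoshi23Price.hull_orbit_jMove`).
[claim: Joshi2023ATS2Local, status: disputed] -/
theorem four_cells [Fact p.Prime] :
    PilotKummerIndRelated (uFull p (Subgroup.zpowers four)).toLatticeSituation (uSetting p _) (uRho p _) (uQDatum p _) ∧
      (uSetting p (Subgroup.zpowers four)).Statement ∧ (uSetting p (Subgroup.zpowers four)).negLogTheta = ((0 : ℝ) : WithTop ℝ) ∧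
      ¬ (uData p (Subgroup.zpowers four)).LogvolInvariant ∧ BridgeHyps (uSetting p (Subgroup.zpowers four)) ∧
      PinnedRegions3 (uFull p (Subgroup.zpowers four)).toLatticeSituation (uSetting p _) (uRho p _) (uQDatum p _) := by
  obtain ⟨h4, hne, hq, -, -, -⟩ := four_sixteen_facts
  exact ⟨(u_residual_iff p _ h4).2 hq, ne_bot_statement p _ h4 hne, ne_bot_negLogTheta p _ h4 hne,
    fun h => hne ((u_logvolInvariant_iff p _ h4).1 h), u_bridgeHyps p _ h4, u_pinnedRegions3 p _ h4⟩

end Summit.ABC.IUTFork.Repair.CandJoshi24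

end
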